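import Summits.BirchSwinnertonDyer.BirchSwinnertonDyer.Theorems.GenusKolyvaginAtTwoMinimalTwinBSDTwoKrizLiAnchorWallSS
import Summits.BirchSwinnertonDyer.BirchSwinnertonDyer.Theorems.GenusKolyvaginAtTwoMinimalTwinBSDTwoKrizLiAnchor189a1
import Summits.BirchSwinnertonDyer.BirchSwinnertonDyer.Theorems.GenusKolyvaginAtTwoMinimalTwinBSDTwoKrizLiAnchor189b1
import HarnessLib

/-!
# Route `GenusKolyvaginAtTwo`, crux U₂ `MinimalTwinBSDTwo` (stmt-BirchSwinnertonDyer-22985), LINE 23 «twin_swap»: THE KRIZ–LI PACKETS OF THE CONDUCTOR-189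
# ANCHORS `189a1`, `189b1` (`N = 3³·7`, good at `2`, `d_K = −47`) ARE U₂-SETTLED MODULO PRINT + THE SUPERSINGULAR WALL ROW ALONE (item 19097) — both are GOOD
# SUPERSINGULAR at `2` (`a₁ = 0` on the minimal model), so their companions by `d ≡ 1 (mod 4)` are too (`…KrizLiAnchorWallSS.lean`)

Seat `bsd-line-gk2-p2` g35 (PROVER 2/3, cell `bsd-f1-sign2`; LINE 23 holder), `--supports stmt-BirchSwinnertonDyer-22985` (helper; closes nothing).
THEOREMS ONLY (0 `def`, 0 `sorry`); standard axioms; route-independent (the supersingular wall row is DISPLAYED as `hSS` in the unfolded shape of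
`Theses.ByReductionTypeAtTwo.SupersingularRankZeroAtTwo`; feed that item by name).  Part III of the instances files `…KrizLiAnchorsSupersingularWall.lean`
(101a1, 131a1, 163a1), `…IIa` (123a1, 123b1, 141a1, 141d1), `…IIb` (155a1, 155c1, 219a1, 219b1) of g34: the g34 roads `…KrizLiAnchor189a1/189b1.lean` are
wall-keyed (all four rank-zero rows, `hS1`); here the SHARPER keying on the single supersingular row, announced in the g34 memo as «one-liner via
`rankOneMembers_of_ssWall` + `goodSS_two_of_even_a₁`».  Per anchor: `goodSS_two_<T>` (kernel: `a₁ = 0`, good at `2`), the sorting theorems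
`rankOneMembers_<T>_of_ssWall` / `rankZeroCompanions_<T>_of_ssWall` and the witness member `d = 17` (`N = 54621`), with ONE research input (item 19097) plus
PRINT (Kriz–Li Thm 5.1 (2) / 4.3, the Table-1 row, Creutz–Miller on the base, GZK for `r_an = 1`).  With the g35 roads for `91a1`/`91b1` (their own `§3`), ALL
SEVENTEEN good-at-`2` non-CM rank-one anchors of Kriz–Li's Table 1 with `c₂` odd are now keyed on the supersingular wall row alone (or on print alone: `37a1`,
`43a1`).  **BSD is NOT proved by any of this; U₂ is NOT proved; item 19097 is OPEN; no item is closed.**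

References: [KrizLi2019] Thm 5.1 (2), Thm 4.3, §6 Ex. 6.2, Table 1 (rows 189a1, 189b1); [CreutzMiller2012] Thm 1.1; [SilvermanAEC2009] V.4, X.2 Prop. 2.4; [Pal2012] Prop. 2.5.
-/

set_option autoImplicit false
-- the Theorems namespace of this sub repeats the summit name by design (D-0017 nested layout)
set_option linter.dupNamespace false

noncomputable section

open scoped Classical

open WeierstrassCurve NumberField Literature.NumberTheory.EllipticCurves
  Literature.NumberTheory.EllipticCurves.ModularForms
  Literature.NumberTheory.EllipticCurves.Rank1Residual
  Literature.NumberTheory.EllipticCurves.Rank1Residual.Typed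
  Summit.BirchSwinnertonDyer.Rank1Residual
  Summit.BirchSwinnertonDyer.Rank1Residual.P2
  Summit.BirchSwinnertonDyer.BirchSwinnertonDyer.Theorems.AddPotGoodPrint
  Summit.BirchSwinnertonDyer.BirchSwinnertonDyer.Theorems.GenusExact.TwinSwap.KrizLiAnchorWall

namespace Summit.BirchSwinnertonDyer.BirchSwinnertonDyer.Theorems.GenusExact.TwinSwap.KrizLiAnchorsSSIII

/-! ## `189a1` -/
section A189A1
open Summit.BirchSwinnertonDyer.BirchSwinnertonDyer.Theorems.GenusExact.TwinSwap.KrizLiAnchor189a1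

/-- **`189a1` is good SUPERSINGULAR at `2`** (`a₁ = 0` on the minimal model, good reduction at `2`). [cite: SilvermanAEC2009, V.4] [cite: KrizLi2019, §6 Example 6.2 and Table 1 (row 189a1)] -/
theorem goodSS_two_189A1 :
    haveI := Summit.BirchSwinnertonDyer.BirchSwinnertonDyer.Theorems.ManinLocalTwoThree.LevelOneEightyNine.isGloballyMinimal_a; haveI : Fact (Nat.Prime 2) := ⟨Nat.prime_two⟩
    GoodSS (⟨0, 0, 1, -3, 0⟩ : WeierstrassCurve ℚ) 2 := by
  haveI := Summit.BirchSwinnertonDyer.BirchSwinnertonDyer.Theorems.ManinLocalTwoThree.LevelOneEightyNine.isElliptic_a; haveI := Summit.BirchSwinnertonDyer.BirchSwinnertonDyer.Theorems.ManinLocalTwoThree.LevelOneEightyNine.isGloballyMinimal_a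
  exact goodSS_two_of_even_a₁ _ hasGoodReductionAtPrime_two_189A1 (by rw [intModel_189A1]; exact ⟨0, rfl⟩)

/-- ★ **THE RANK-ONE MEMBERS `189a1^{(d)}` — U₂-class curves settled MODULO PRINT + THE SUPERSINGULAR WALL ROW (19097) ALONE**: at every global minimal
`W₁ ≅ 189a1^{(d)}` (`d ∈ 𝒩(189a1, K)`, `d_K = -47`, `χ_d(−189) = 1`): `r_an(W₁) = 1 ∧ ¬CM ∧ BSD(W₁, 2)`.  BSD is not proved by any of this; U₂ is not proved.
[cite: KrizLi2019, Thm. 5.1 (2), Thm. 4.3, §6 Table 1 (row 189a1)] [cite: CreutzMiller2012, Thm. 1.1] -/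
theorem rankOneMembers_189A1_of_ssWall (hKL : KrizLi2019.thm112_bsdTwo_twist) (h33 : KrizLi2019.thm33_rank_twist)
    (htab : KrizLi2019.table1_row189a1) (hS31 : bsdTriple_of_analyticRank_le_one_of_conductor_lt)
    (hGZK : rank_eq_analyticRank_of_analyticRank_le_one)
    (hSS : ∀ (W : WeierstrassCurve ℚ) [W.IsElliptic] [W.IsGloballyMinimal], ¬ W.HasCM → W.analyticRank = 0 →
      (haveI : Fact (Nat.Prime 2) := ⟨Nat.prime_two⟩; GoodSS W 2) → BSDp W 2)
    (K : Type) [Field K] [NumberField K] (hK : IsImaginaryQuadratic K) (hdK : NumberField.discr K = -47)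
    {d : ℤ} (hd : haveI := Summit.BirchSwinnertonDyer.BirchSwinnertonDyer.Theorems.ManinLocalTwoThree.LevelOneEightyNine.isGloballyMinimal_a; KrizLi2019.InN (⟨0, 0, 1, -3, 0⟩ : WeierstrassCurve ℚ) K d)
    (hsign : haveI := Summit.BirchSwinnertonDyer.BirchSwinnertonDyer.Theorems.ManinLocalTwoThree.LevelOneEightyNine.isElliptic_a; Int.sign d * jacobiSym ((⟨0, 0, 1, -3, 0⟩ : WeierstrassCurve ℚ).conductorNorm ℤ) d.natAbs = 1)
    (W₁ : WeierstrassCurve ℚ) [W₁.IsElliptic] [W₁.IsGloballyMinimal]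
    (hW₁ : ∃ C : VariableChange ℚ, C • (⟨0, 0, 1, -3, 0⟩ : WeierstrassCurve ℚ).quadraticTwist (d : ℚ) = W₁) :
    W₁.analyticRank = 1 ∧ ¬ W₁.HasCM ∧ BSDp W₁ 2 := by
  haveI := Summit.BirchSwinnertonDyer.BirchSwinnertonDyer.Theorems.ManinLocalTwoThree.LevelOneEightyNine.isElliptic_a; haveI := Summit.BirchSwinnertonDyer.BirchSwinnertonDyer.Theorems.ManinLocalTwoThree.LevelOneEightyNine.isGloballyMinimal_a
  obtain ⟨_, Dt, H, ι, P, j, -, hP, hstar⟩ := htab K hK hdK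
  exact rankOneMembers_of_ssWall _ hKL h33 hS31 hSS goodSS_two_189A1 conductorNorm_lt_5000_189A1 not_hasCM_189A1 (analyticRank_189A1 h33 htab hGZK)
    twoTorsion_189A1 K hK (by rw [hdK]; decide) (satisfiesHeegnerHypothesis_189A1 hK.1 hdK) Dt H ι P hP j hstar (krizLi_loc_189A1 Dt) hd hsign W₁ hW₁

/-- **THE RANK-ZERO COMPANIONS `189a1^{(-47d)}`** under the supersingular wall row: `r_an = 0 ∧ ¬CM ∧ GoodSS ∧ BSD(·, 2)` — members of item 19097's own class.
BSD is not proved by any of this. [cite: KrizLi2019, Thm. 5.1 (2), Thm. 4.3, §6 Table 1 (row 189a1)] [cite: CreutzMiller2012, Thm. 1.1] -/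
theorem rankZeroCompanions_189A1_of_ssWall (hKL : KrizLi2019.thm112_bsdTwo_twist) (h33 : KrizLi2019.thm33_rank_twist)
    (htab : KrizLi2019.table1_row189a1) (hS31 : bsdTriple_of_analyticRank_le_one_of_conductor_lt)
    (hGZK : rank_eq_analyticRank_of_analyticRank_le_one)
    (hSS : ∀ (W : WeierstrassCurve ℚ) [W.IsElliptic] [W.IsGloballyMinimal], ¬ W.HasCM → W.analyticRank = 0 →
      (haveI : Fact (Nat.Prime 2) := ⟨Nat.prime_two⟩; GoodSS W 2) → BSDp W 2)
    (K : Type) [Field K] [NumberField K] (hK : IsImaginaryQuadratic K) (hdK : NumberField.discr K = -47)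
    {d : ℤ} (hd : haveI := Summit.BirchSwinnertonDyer.BirchSwinnertonDyer.Theorems.ManinLocalTwoThree.LevelOneEightyNine.isGloballyMinimal_a; KrizLi2019.InN (⟨0, 0, 1, -3, 0⟩ : WeierstrassCurve ℚ) K d)
    (hsign : haveI := Summit.BirchSwinnertonDyer.BirchSwinnertonDyer.Theorems.ManinLocalTwoThree.LevelOneEightyNine.isElliptic_a; Int.sign d * jacobiSym ((⟨0, 0, 1, -3, 0⟩ : WeierstrassCurve ℚ).conductorNorm ℤ) d.natAbs = 1)
    (W₂ : WeierstrassCurve ℚ) [W₂.IsElliptic] [W₂.IsGloballyMinimal]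
    (hW₂ : ∃ C : VariableChange ℚ, C • (⟨0, 0, 1, -3, 0⟩ : WeierstrassCurve ℚ).quadraticTwist ((d * NumberField.discr K : ℤ) : ℚ) = W₂) :
    haveI : Fact (Nat.Prime 2) := ⟨Nat.prime_two⟩
    W₂.analyticRank = 0 ∧ ¬ W₂.HasCM ∧ GoodSS W₂ 2 ∧ BSDp W₂ 2 := by
  haveI := Summit.BirchSwinnertonDyer.BirchSwinnertonDyer.Theorems.ManinLocalTwoThree.LevelOneEightyNine.isElliptic_a; haveI := Summit.BirchSwinnertonDyer.BirchSwinnertonDyer.Theorems.ManinLocalTwoThree.LevelOneEightyNine.isGloballyMinimal_a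
  obtain ⟨_, Dt, H, ι, P, j, -, hP, hstar⟩ := htab K hK hdK
  exact rankZeroCompanions_of_ssWall _ hKL h33 hS31 hSS goodSS_two_189A1 conductorNorm_lt_5000_189A1 not_hasCM_189A1 (analyticRank_189A1 h33 htab hGZK)
    twoTorsion_189A1 K hK (by rw [hdK]; decide) (satisfiesHeegnerHypothesis_189A1 hK.1 hdK) Dt H ι P hP j hstar (krizLi_loc_189A1 Dt) hd hsign W₂ hW₂

/-- **The witness member `189a1^{(17)}`** (rank one, `N = 54621`): `r_an = 1 ∧ ¬CM ∧ BSD(·, 2)` modulo PRINT + item 19097. BSD is not proved by any of this.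
[cite: KrizLi2019, Thm. 5.1 (2), Thm. 4.3, §6 Table 1 (row 189a1)] [cite: CreutzMiller2012, Thm. 1.1] -/
theorem rankOneMember_witness_189A1_of_ssWall (hKL : KrizLi2019.thm112_bsdTwo_twist) (h33 : KrizLi2019.thm33_rank_twist)
    (htab : KrizLi2019.table1_row189a1) (hS31 : bsdTriple_of_analyticRank_le_one_of_conductor_lt)
    (hGZK : rank_eq_analyticRank_of_analyticRank_le_one)
    (hSS : ∀ (W : WeierstrassCurve ℚ) [W.IsElliptic] [W.IsGloballyMinimal], ¬ W.HasCM → W.analyticRank = 0 →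
      (haveI : Fact (Nat.Prime 2) := ⟨Nat.prime_two⟩; GoodSS W 2) → BSDp W 2)
    (K : Type) [Field K] [NumberField K] (hK : IsImaginaryQuadratic K) (hdK : NumberField.discr K = -47)
    (W₁ : WeierstrassCurve ℚ) [W₁.IsElliptic] [W₁.IsGloballyMinimal]
    (hW₁ : ∃ C : VariableChange ℚ, C • (⟨0, 0, 1, -3, 0⟩ : WeierstrassCurve ℚ).quadraticTwist ((17 : ℤ) : ℚ) = W₁) :
    W₁.analyticRank = 1 ∧ ¬ W₁.HasCM ∧ BSDp W₁ 2 :=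
  rankOneMembers_189A1_of_ssWall hKL h33 htab hS31 hGZK hSS K hK hdK (inN_witness_189A1 hK.1 hdK) sign_witness_189A1 W₁ hW₁

end A189A1

/-! ## `189b1` -/
section A189B1
open Summit.BirchSwinnertonDyer.BirchSwinnertonDyer.Theorems.GenusExact.TwinSwap.KrizLiAnchor189b1

/-- **`189b1` is good SUPERSINGULAR at `2`** (`a₁ = 0` on the minimal model, good reduction at `2`). [cite: SilvermanAEC2009, V.4] [cite: KrizLi2019, §6 Example 6.2 and Table 1 (row 189b1)] -/
theorem goodSS_two_189B1 :
    haveI := isGloballyMinimal_189B1; haveI : Fact (Nat.Prime 2) := ⟨Nat.prime_two⟩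
    GoodSS (⟨0, 0, 1, -24, 45⟩ : WeierstrassCurve ℚ) 2 := by
  haveI := isElliptic_189B1; haveI := isGloballyMinimal_189B1
  exact goodSS_two_of_even_a₁ _ hasGoodReductionAtPrime_two_189B1 (by rw [intModel_189B1]; exact ⟨0, rfl⟩)

/-- ★ **THE RANK-ONE MEMBERS `189b1^{(d)}` — U₂-class curves settled MODULO PRINT + THE SUPERSINGULAR WALL ROW (19097) ALONE**: at every global minimal
`W₁ ≅ 189b1^{(d)}` (`d ∈ 𝒩(189b1, K)`, `d_K = -47`, `χ_d(−189) = 1`): `r_an(W₁) = 1 ∧ ¬CM ∧ BSD(W₁, 2)`.  BSD is not proved by any of this; U₂ is not proved.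
[cite: KrizLi2019, Thm. 5.1 (2), Thm. 4.3, §6 Table 1 (row 189b1)] [cite: CreutzMiller2012, Thm. 1.1] -/
theorem rankOneMembers_189B1_of_ssWall (hKL : KrizLi2019.thm112_bsdTwo_twist) (h33 : KrizLi2019.thm33_rank_twist)
    (htab : KrizLi2019.table1_row189b1) (hS31 : bsdTriple_of_analyticRank_le_one_of_conductor_lt)
    (hGZK : rank_eq_analyticRank_of_analyticRank_le_one)
    (hSS : ∀ (W : WeierstrassCurve ℚ) [W.IsElliptic] [W.IsGloballyMinimal], ¬ W.HasCM → W.analyticRank = 0 →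
      (haveI : Fact (Nat.Prime 2) := ⟨Nat.prime_two⟩; GoodSS W 2) → BSDp W 2)
    (K : Type) [Field K] [NumberField K] (hK : IsImaginaryQuadratic K) (hdK : NumberField.discr K = -47)
    {d : ℤ} (hd : haveI := isGloballyMinimal_189B1; KrizLi2019.InN (⟨0, 0, 1, -24, 45⟩ : WeierstrassCurve ℚ) K d)
    (hsign : haveI := isElliptic_189B1; Int.sign d * jacobiSym ((⟨0, 0, 1, -24, 45⟩ : WeierstrassCurve ℚ).conductorNorm ℤ) d.natAbs = 1)
    (W₁ : WeierstrassCurve ℚ) [W₁.IsElliptic] [W₁.IsGloballyMinimal]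
    (hW₁ : ∃ C : VariableChange ℚ, C • (⟨0, 0, 1, -24, 45⟩ : WeierstrassCurve ℚ).quadraticTwist (d : ℚ) = W₁) :
    W₁.analyticRank = 1 ∧ ¬ W₁.HasCM ∧ BSDp W₁ 2 := by
  haveI := isElliptic_189B1; haveI := isGloballyMinimal_189B1
  obtain ⟨_, Dt, H, ι, P, j, -, hP, hstar⟩ := htab K hK hdK
  exact rankOneMembers_of_ssWall _ hKL h33 hS31 hSS goodSS_two_189B1 conductorNorm_lt_5000_189B1 not_hasCM_189B1 (analyticRank_189B1 h33 htab hGZK)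
    twoTorsion_189B1 K hK (by rw [hdK]; decide) (satisfiesHeegnerHypothesis_189B1 hK.1 hdK) Dt H ι P hP j hstar (krizLi_loc_189B1 Dt) hd hsign W₁ hW₁

/-- **THE RANK-ZERO COMPANIONS `189b1^{(-47d)}`** under the supersingular wall row: `r_an = 0 ∧ ¬CM ∧ GoodSS ∧ BSD(·, 2)` — members of item 19097's own class.
BSD is not proved by any of this. [cite: KrizLi2019, Thm. 5.1 (2), Thm. 4.3, §6 Table 1 (row 189b1)] [cite: CreutzMiller2012, Thm. 1.1] -/
theorem rankZeroCompanions_189B1_of_ssWall (hKL : KrizLi2019.thm112_bsdTwo_twist) (h33 : KrizLi2019.thm33_rank_twist)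
    (htab : KrizLi2019.table1_row189b1) (hS31 : bsdTriple_of_analyticRank_le_one_of_conductor_lt)
    (hGZK : rank_eq_analyticRank_of_analyticRank_le_one)
    (hSS : ∀ (W : WeierstrassCurve ℚ) [W.IsElliptic] [W.IsGloballyMinimal], ¬ W.HasCM → W.analyticRank = 0 →
      (haveI : Fact (Nat.Prime 2) := ⟨Nat.prime_two⟩; GoodSS W 2) → BSDp W 2)
    (K : Type) [Field K] [NumberField K] (hK : IsImaginaryQuadratic K) (hdK : NumberField.discr K = -47)
    {d : ℤ} (hd : haveI := isGloballyMinimal_189B1; KrizLi2019.InN (⟨0, 0, 1, -24, 45⟩ : WeierstrassCurve ℚ) K d)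
    (hsign : haveI := isElliptic_189B1; Int.sign d * jacobiSym ((⟨0, 0, 1, -24, 45⟩ : WeierstrassCurve ℚ).conductorNorm ℤ) d.natAbs = 1)
    (W₂ : WeierstrassCurve ℚ) [W₂.IsElliptic] [W₂.IsGloballyMinimal]
    (hW₂ : ∃ C : VariableChange ℚ, C • (⟨0, 0, 1, -24, 45⟩ : WeierstrassCurve ℚ).quadraticTwist ((d * NumberField.discr K : ℤ) : ℚ) = W₂) :
    haveI : Fact (Nat.Prime 2) := ⟨Nat.prime_two⟩
    W₂.analyticRank = 0 ∧ ¬ W₂.HasCM ∧ GoodSS W₂ 2 ∧ BSDp W₂ 2 := by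
  haveI := isElliptic_189B1; haveI := isGloballyMinimal_189B1
  obtain ⟨_, Dt, H, ι, P, j, -, hP, hstar⟩ := htab K hK hdK
  exact rankZeroCompanions_of_ssWall _ hKL h33 hS31 hSS goodSS_two_189B1 conductorNorm_lt_5000_189B1 not_hasCM_189B1 (analyticRank_189B1 h33 htab hGZK)
    twoTorsion_189B1 K hK (by rw [hdK]; decide) (satisfiesHeegnerHypothesis_189B1 hK.1 hdK) Dt H ι P hP j hstar (krizLi_loc_189B1 Dt) hd hsign W₂ hW₂

/-- **The witness member `189b1^{(17)}`** (rank one, `N = 54621`): `r_an = 1 ∧ ¬CM ∧ BSD(·, 2)` modulo PRINT + item 19097. BSD is not proved by any of this.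
[cite: KrizLi2019, Thm. 5.1 (2), Thm. 4.3, §6 Table 1 (row 189b1)] [cite: CreutzMiller2012, Thm. 1.1] -/
theorem rankOneMember_witness_189B1_of_ssWall (hKL : KrizLi2019.thm112_bsdTwo_twist) (h33 : KrizLi2019.thm33_rank_twist)
    (htab : KrizLi2019.table1_row189b1) (hS31 : bsdTriple_of_analyticRank_le_one_of_conductor_lt)
    (hGZK : rank_eq_analyticRank_of_analyticRank_le_one)
    (hSS : ∀ (W : WeierstrassCurve ℚ) [W.IsElliptic] [W.IsGloballyMinimal], ¬ W.HasCM → W.analyticRank = 0 →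
      (haveI : Fact (Nat.Prime 2) := ⟨Nat.prime_two⟩; GoodSS W 2) → BSDp W 2)
    (K : Type) [Field K] [NumberField K] (hK : IsImaginaryQuadratic K) (hdK : NumberField.discr K = -47)
    (W₁ : WeierstrassCurve ℚ) [W₁.IsElliptic] [W₁.IsGloballyMinimal]
    (hW₁ : ∃ C : VariableChange ℚ, C • (⟨0, 0, 1, -24, 45⟩ : WeierstrassCurve ℚ).quadraticTwist ((17 : ℤ) : ℚ) = W₁) :
    W₁.analyticRank = 1 ∧ ¬ W₁.HasCM ∧ BSDp W₁ 2 :=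
  rankOneMembers_189B1_of_ssWall hKL h33 htab hS31 hGZK hSS K hK hdK (inN_witness_189B1 hK.1 hdK) sign_witness_189B1 W₁ hW₁

end A189B1

end Summit.BirchSwinnertonDyer.BirchSwinnertonDyer.Theorems.GenusExact.TwinSwap.KrizLiAnchorsSSIII

end
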